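import Summits.QuantumFields.YangMills.Theorems.BalabanUVNodesN12AtRecord13Prop1KnitThm1OfRecord
import Literature.MathematicalPhysics.QuantumFieldTheory.Balaban1983to89.B15Prop1EndpointNearFlatLetters
import Literature.MathematicalPhysics.QuantumFieldTheory.Balaban1983to89.Node00.Record13NumericsOfThm1CCMW

/-!
# BalabanUVNodes ∕ N12 — N12's PROPOSITION-1 ROW AT THE RECORD FED BY THE w-WAVE's LOCALISED ASSEMBLED ENDPOINT (J-C v1.2): 12Q⁷ `…N12AtRecord13Prop1KnitThm1NearFlatOfRecord` (p612809)
# RE-KEYED on dag-n12-c g17's `B15Prop1EndpointNearFlatLetters` §5 `…_ofThm1TorusClass_ofMinimiserFamilyCompact_ofNearFlatLetters_sub_loc_oneSided` (p618172, the LOCATED-hU repair: near-flatness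
# of `U₀` demanded only on plaquettes with a bond sourced in `Ω₁(Z)`, where the chart family moves — dag-n12-w4's (r1) `B16Ineq17NearFlatWilsonLettersLocal` + dag-n12-w5's (r2)
# `B15Prop1RealChartFamilySupport` inside; plus v1.1's twist defect `τc`; bus l.31948/l.≈32150: «12Q⁸ target BY NAME») — the (L2) Hessian letter `h17` is REPLACED by the w-wave's NEAR-FLAT LETTER PACKAGE (N) per run,
# instance and base field in the strict guard, with five nonnegative constant families `δc μc ρc δ₂c Kc`; everything else as in 12Q⁶ ((J0′) compact-uniform `hMinC`, `[∀ P, Finite (ι P)]`, radius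
# PRODUCED, [15] input = NODE 00's (8) ∕ at the V19 door the door letter `h15`) (Track A, DAG node N12 = [B15, Balaban1989LargeFieldI] CMP **122** (1989) 175–202; cluster K1 — K1⁷
# `StabilityBAtRecordR13SepCoPH` = stmt-QuantumFields-20542, helper; seat `pub-ymgap-dag-n12-d` g16 (R134 s2 «knit at the record»), 2026-08-28; count-neutral, CONDITIONAL, NOT a discharge)

HONEST FRAMING.  Count-neutral kernel bookkeeping BY NAME over landed modules: 12Q⁶ (this seat; statement shapes and proof terms), dag-n12-c g17's assembled endpoint (composition by name of
dag-n12-w4's `B16Ineq17NearFlatDatumFamily.haff_msChart_of_isMinimizer_family` (δ₁)∕(β) from a family of (2.12)-minimisers near `U₀`, n12-c's `B15Prop1SliceHessianOfChartFamily` (`hval` from the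
family, then the one-sided clause), dag-n12-w3's `exists_lieSU2Coord`, and n12-c g17 §4's compactness endpoint), 12Q⁵ §0's junction, 12E's row, K0a's witnesses.  WHAT CHANGES relative to 12Q⁷
(binders only; no new mathematics): the package (N) `hNF`'s first conjunct is LOCALISED — per run `P`, instance `i`, base field `V_k` in the STRICT guard: a `U₀` that is `δc`-near-flat on the
four bonds of every plaquette having a bond sourced in `maxDomT ν.M₁ (Z P i) 1` (NOT on all bonds — dag-n12-w5's LOCATED-hU: the all-bonds form is not inhabitable at a large-field datum), a `C²` family `X_f` with `X_f 0 = 0` whose exponential charts at `U₀` are (2.12)-minimisers for the averaged shifted base fields near `0` ((K′), the dag-n12-w5∕w1 (L2)-side letter), the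
multi-scale fibre chart's regularity at `U₀` (`Ψ₂`, differentiability near `0`), the Lagrange form `lam` of `dA(expChart U₀ ·)(0)` through `d msChart(0)`, a seminorm `p` dominating the bond `ℓ²` norm, a
right inverse `Rf` of `Lf` with `p ∘ Rf ≤ ρc·q`, and per tangent `X`: (δ₂) the defect `q(dmsChart(0)(dX_f X) − Lf(dX_f X)) ≤ δ₂c·p`, (μ) `lam(Ψ₂ ·,·) ≤ μc·p²`, (K) `p(dX_f X) ≤ Kc‖X‖`, and a
number `m` below the flat Hessian at `Lf`'s point and above `γ₀ ·` the curl form MINUS the twist defect `τc·‖X‖²` (v1.1) — VERBATIM dag-n12-c's text, indexed per run; a sixth constant family `τc`;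
the four sign families `hδc0 hμc0 hρc0 hδ₂c0`; and `hsm` in the assembled form `(32(d−1)δc + μc + 16(d−1)ρcδ₂c(2+ρcδ₂c))·Kc² + τc ≤ γ₀∕(2(3K²+2K⁴))`.  No `hdec`∕`hcl` binder is passed (the endpoint is stated at the tree's ambient bond decidability).  WHAT STAYS
A LETTER per run ∕ instance: (J0′) `hMinC` (dag-n12-w1∕w6's compactness road), the package (N) (dag-n12-w4∕w5's chart road + NODE 00's multi-scale fibre chart letters), `hsm`∕`hγle`, (Gᵃ)
`hZblk`, `hM2` (generic `Θ`) + `hdiv`, `hZ1`, `hk0`∕`hk`, box data, `[Finite (ι P)]`; K0b's residuals `hres` (generic `Θ`); N12's per-run displays below the torus ((1.100) pin, live-mass —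
NODE 00 —, (1.80), (1.89)); and (8) ∕ `h15` — a HYPOTHESIS (K0⁷'s ∕ the door's), never asserted.  Nothing of Bałaban's is asserted; N12 is NOT discharged; no node is discharged; K0⁷ ∕ K1⁷
NOT closed; counts unmoved (discharged 5∕27 · Track A 5∕28).  TYPING NOTE: as in 12Q⁵∕12Q⁶ (`B14.…` prefixes for NODE 00 homonyms; Node00 names unqualified under `open … Node00`; `lieSU`,
`expChart`, `msChart`, `constrCard`, `wilsonAction4` as in dag-n12-c's file).  ONE finite four-torus programme at fixed `ε = L^{-K}` — nothing continuum ∕ ℝ⁴ ∕ OS ∕ mass gap ∕ Clay.  No `sorry`,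
`def`, `instance`, `notation`.

Sources: [Balaban1989LargeFieldI] (0.2)–(0.6) p.176, (1.74) p.192, p.193 ll.14–20, Prop. 1 (1.77)–(1.78) p.194, (1.79)–(1.80) p.195, (1.89) p.198, (1.99)–(1.102) pp.200–201; [Balaban1989LargeFieldII]
(1.7)–(1.9) p.358, (1.11)–(1.13) p.359, (17)–(19) pp.360–361; [Balaban1988Convergent] (2.1) p.254, (2.5) p.255, (2.12)–(2.14) pp.256–257, (2.18) p.257, (3.16) p.268, (3.22)–(3.25) pp.269–270;
[Balaban1985Variational] (1) p.277, (7) p.278, Thm 1 (8)–(9) p.279, Prop. 9 (190) p.309; [Balaban1985RegularSpaces] (1.3)–(1.9) p.77; [Balaban1987RG1] Thm 1 p.259 (bookkeeping).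
-/

noncomputable section
open MeasureTheory Set Finset Metric Filter
open scoped Matrix.Norms.L2Operator BigOperators Matrix RealInnerProductSpace Real InnerProductSpace Topology

namespace Summit.QuantumFields.YangMills.BalabanUVNodes.N12AtRecord13Prop1KnitThm1NearFlatLocOfRecord

open Literature.MathematicalPhysics.QuantumFieldTheory.Balaban1983to89
open Literature.MathematicalPhysics.QuantumFieldTheory.Balaban1983to89.T4Continuum (T4Family)
open Literature.MathematicalPhysics.QuantumFieldTheory.Balaban1983to89.DagBinding
open Literature.MathematicalPhysics.QuantumFieldTheory.Balaban1983to89.Node00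
open B15Claim189Assembly (new189 chiPP dom)
open B15 (Prop1Printed Ineq180)
open B15.BasicStep (Claim189)
open B8Eq17ClassAkV1 (plaqsOf)
open B15RPrime1100OfRep (rPrimeDataOfSel)
open Summit.QuantumFields.YangMills.BalabanUVNodes.N12AtRecord13OfResiduals (b15Leaf_WOfRecord₁₃_liveRepin₁₃_of_massLive_of_hasResiduals)
open Summit.QuantumFields.YangMills.BalabanUVNodes.N12AtRecord13Prop1KnitThm1OfRecord (thm1TorusClass_of_variationalThm1RegSepCoP7M)
-- dag-n12-c's vocabulary (as opened in 12Q⁵ ∕ `B15Prop1ClosedGuardUniformRadius`)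
open B15DeterminingSets (pts DetBackground genSet IsMinimizer MSField avgFamily)
open B15Prop1Carrier (lfVarOn InstOn InstOn.std plaqsInside)
open B15Prop1EndpointNearFlatLetters (exists_domain_prop1Printed_lfVarOn_std_su2_box_intrinsic_analytic_atZSeqCoPRecord_ofThm1TorusClass_ofMinimiserFamilyCompact_ofNearFlatLetters_sub_loc_oneSided)
open T4AdjointCovarianceUnitary (lieSU)
open B15Prop1GradientFromNearValueAtCoPRecord (far_letter_of_box)
open B15Prop1AnalyticExtClause (cplxVec anExt)
open B15Prop1ChartCalculusSU2 (E3)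
open T4CubeChartGnomonic (SU2)
open B15Prop1ChartSU2 (su2Chart)
open B15Prop1SliceCoordinates (GaugeSlice ιA)
open B15Prop1SliceTaylorCalculus (rGrad sliceFn)
open T4AxialGaugeSmallField (castSite boxPlaqs)
open B6BondElimination (unitVec)
open B6TreeGaugePoincare (curl)
open B16Eq18Proof (box)
open B15Extension193 (extend)
open B15ShellGauge193 (shellGauge)
open B15Sect1Instances (fun177std)
open B14.Eq213DetSet (Bj maxDomT)
open Literature.MathematicalPhysics.QuantumFieldTheory.BalabanImbrieJaffe1984to88.BIJ85Eq453GaugeField (qsstarGIter0)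
open B16Sect1Backgrounds (expMul)
open GaugeGroup (dist1)

variable {F : T4Family}

/-! ## §1 `N = 2`, generic `Θ` carrying node00-def-K0b's residuals: 12Q⁶ §1 with (L2) `h17` ↦ the LOCALISED near-flat letter package (N) of the w-wave (dag-n12-c g17 J-C v1.2) -/

section RecordAtZSeqNearFlat
variable (Θ : Stage13Params F 2) (lam : ResidW F 2)

/-- **★★★★ N12's ROW BELOW THE TORUS AT THE LIVE RE-PIN, `N = 2`, AT PRINT's (1.74) OBJECT, (L2) FROM THE w-WAVE's LOCALISED NEAR-FLAT LETTER PACKAGE (N)** — 12Q⁷ §1 with dag-n12-c g17's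
assembled endpoint replaced by its v1.2 LOCALISED edition `…_ofMinimiserFamilyCompact_ofNearFlatLetters_sub_loc_oneSided` (near-flatness of `U₀` only on plaquettes with a bond sourced in `Ω₁(Z)`; twist defect `τc`), run by run: per run `P` and instance `i : ι P` the configuration letter is (J0′)
`hMinC` (compact-uniform), the Hessian letter is the package (N) `hNF` at every base field in the strict guard (with constants `δc μc ρc δ₂c Kc` and `hsm` in the assembled form), the instance
index is FINITE, the conclusion PRODUCES the radii `R P i` and the thresholds `areg P i` at which the pinned LF layer's leaf holds; [15] input = NODE 00's (8) via 12Q⁵ §0's junction; `hfar` from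
`hZ1` by `far_letter_of_box`; then 12E's `b15Leaf_WOfRecord₁₃_liveRepin₁₃_of_massLive_of_hasResiduals`.  WHAT STAYS A LETTER: (J0′) `hMinC`, (N) `hNF` + signs + `hsm`∕`hγle`, (Gᵃ) `hZblk`, `hM2` +
`hdiv`, `hZ1`, `hk0`∕`hk`, box data, `[Finite (ι P)]`; K0b's residuals `hres`; N12's per-run displays below the torus ((1.100) pin, live-mass, (1.80), (1.89)); AND (8) itself — a HYPOTHESIS
(K0⁷'s), never asserted.  Count-neutral; NOT a discharge of N12. [cite: Balaban1989LargeFieldI, (0.2)–(0.6) p.176, (1.74) p.192, p.193 ll.14–20, Prop. 1 (1.77)–(1.78) p.194, (1.79)–(1.80) p.195, (1.89) p.198, (1.99)–(1.102) pp.200–201; Balaban1989LargeFieldII, (1.7)–(1.9) p.358, (1.11)–(1.13) p.359, (17)–(19) pp.360–361; Balaban1988Convergent, (2.1) p.254, (2.5) p.255, (2.12)–(2.14) pp.256–257, (2.18) p.257, (3.16) p.268, (3.22)–(3.25) pp.269–270; Balaban1985Variational, (1) p.277, (7) p.278, Thm 1 (8) p.279, Prop. 9 (190) p.309; Balaban1985RegularSpaces,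 (1.3)–(1.9) p.77 (bookkeeping)] -/
theorem exists_radius_pinLF_b15Leaf_WOfRecord₁₃_liveRepin₁₃_of_massLive_of_hasResiduals_of_variationalThm1RegSepCoP7M_atZSeqCoPRecord_nearFlatLoc (hres : Θ.HasResidualsOfRecord F 2)
    -- N12's displays at the letters `kSel ∕ D189 ∕ D1100` of `λ`, run by run, BELOW THE TORUS
    (hpin : ∀ P : B12.RunParams, lam.kSel P < P.K → lam.D1100 P
      = rPrimeDataOfSel (reprTOfRecord₁₃ F 2 (Θ.liveRepin₁₃ F 2) P (lam.kSel P))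
          ((Θ.liveRepin₁₃ F 2).ppSel P (gOfRecord₁₃ F 2 (Θ.liveRepin₁₃ F 2) P) (lam.kSel P + 1))
          (fibOfSeq F (Θ.liveRepin₁₃ F 2).ν (Θ.liveRepin₁₃ F 2).τ9 P (gOfRecord₁₃ F 2 (Θ.liveRepin₁₃ F 2) P) (lam.kSel P + 1)))
    (hmassLive : ∀ P : B12.RunParams, lam.kSel P < P.K → ∀ s, LiveSeq F 2 Θ.ν Θ.τ9 P (gOfRecord₁₃ F 2 (Θ.liveRepin₁₃ F 2) P) (lam.kSel P + 1)
        (slotsTOfRecord F 2 Θ.ν Θ.τ9 (EOfRecord₁₃ F 2 (Θ.liveRepin₁₃ F 2)) (wOfRecord₉ F 2 (Θ.liveRepin₁₃ F 2).toStage9Params)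
          (Θ.liveRepin₁₃ F 2).ppSel P (gOfRecord₁₃ F 2 (Θ.liveRepin₁₃ F 2) P) (lam.kSel P + 1)) s →
      0 < ∫ V, rterm (reprTOfRecord₁₃ F 2 (Θ.liveRepin₁₃ F 2) P (lam.kSel P)) s V ∂(fieldMeasure (F.P P.K) (lam.kSel P + 1) (SU 2)))
    (h180 : ∀ P : B12.RunParams, lam.kSel P < P.K → ∀ U, new189 (lam.D189 P) U → ∀ i, (lam.D189 P).h ≤ i → i ≤ (lam.D189 P).k →
      ∀ q ∈ plaqsOf (dom (lam.D189 P) i),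
        Ineq180 ((lam.D189 P).dev0 U q) ((lam.D189 P).ε (lam.D189 P).k) (lam.D189 P).η (lam.D189 P).B₃ (lam.D189 P).B₅ (lam.D189 P).M (lam.D189 P).δ
          ((lam.D189 P).dist q) (lam.D189 P).O1)
    (h189 : ∀ P : B12.RunParams, lam.kSel P < P.K → Claim189 (new189 (lam.D189 P)) (chiPP (lam.D189 P)))
    -- dag-n12-c's Proposition-1 instance data ON THE RUN's LATTICE `F.P P.K`, per run `P` and instance `i : ι P` (structural ∕ constants, exactly as in its endpoint of record)
    (hd3 : ∀ P : B12.RunParams, 3 ≤ (F.P P.K).d) (h0 : ∀ P : B12.RunParams, 0 < (F.P P.K).d) (ι : B12.RunParams → Type)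
    -- the instance index of EVERY run is FINITE (dag-n12-c g17: on one finite lattice the instances `(Z, Λ^{(k)}, k, M)` of [IV] Prop. 1 form a finite set — the price of the
    -- compactness route's existential radius; print's radius is explicit, (1.13) p. 359)
    [hfin : ∀ P : B12.RunParams, Finite (ι P)]
    -- NO background letters: per instance the class is that of `Z P i`'s OWN maximal sequence `maxDomT Θ.ν.M₁ (Z P i)` up to scale `k P i` (dag-n12-c LOCATED-CLASS)
    (Z Λ : ∀ P : B12.RunParams, ι P → Set (Site (F.P P.K) 0))
    (k : ∀ P : B12.RunParams, ι P → ℕ) (M : ∀ P : B12.RunParams, ι P → ℝ) (hk0 : ∀ P i, 0 < k P i) (hk : ∀ P i, k P i ≤ (F.P P.K).m + (F.P P.K).K)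
    (eR : ∀ P : B12.RunParams, ι P → ℝ) (heR : ∀ P i, 0 < eR P i)
    (T : ∀ (P : B12.RunParams) (i : ι P), Finset (PBond (F.P P.K) (k P i)))
    (lo hi : ∀ P : B12.RunParams, ι P → Fin (F.P P.K).d → ℤ) (n : ∀ P : B12.RunParams, ι P → ℕ) (hn : ∀ P i κ, hi P i κ ≤ lo P i κ + n P i)
    (hN : ∀ P i, n P i + 2 < (F.P P.K).sitesPerDir (k P i))
    (hbox : ∀ P i, pts (k P i) (Λ P i) = (castSite '' Set.Icc (lo P i) (hi P i) : Set (Site (F.P P.K) (k P i))))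
    (hZ : ∀ P i, (boxPlaqs (lo P i - 1) (hi P i + 1) : Set (Plaq (F.P P.K) (k P i))) ⊆ plaqsInside (pts (k P i) (Z P i)))
    (hTG0 : ∀ P i, T P i = (box (fun κ => (hi P i κ - lo P i κ + 1).toNat) (lo P i)).image fun x =>
      (⟨castSite (x - unitVec ⟨0, h0 P⟩), ⟨0, h0 P⟩⟩ : PBond (F.P P.K) (k P i)))
    (hN5 : ∀ P i κ, ((hi P i κ - lo P i κ + 1).toNat : ℤ) + 5 < (F.P P.K).sitesPerDir (k P i))
    (Kb : ∀ P : B12.RunParams, ι P → ℕ) (hK1 : ∀ P i, 1 ≤ Kb P i) (hKn : ∀ P i κ, (hi P i κ - lo P i κ + 1).toNat ≤ Kb P i)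
    (ext : ∀ (P : B12.RunParams) (i : ι P), GaugeField (F.P P.K) (k P i) SU2 → GaugeField (F.P P.K) (k P i) SU2)
    (hext : ∀ P i Vk, ext P i Vk = extend (pts (k P i) (Λ P i)) (shellGauge Vk (lo P i) (hi P i)) Vk)
    (hlohi : ∀ P i, lo P i ≤ hi P i)
    {γ bx : B12.RunParams → ℝ} (hγ : ∀ P, 0 < γ P) (hbx : ∀ P, 0 ≤ bx P)
    (hbxM : ∀ P i, 12 * ((F.P P.K).d : ℝ) * ((n P i : ℝ) + 2) ^ 2 ≤ bx P * (M P i) ^ 2)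
    {𝓐₀ : ∀ P : B12.RunParams, ι P → ℝ} (hM : ∀ P i, 1 ≤ M P i)
    {γ₀ : B12.RunParams → ℝ} (hγ₀ : ∀ P, 0 ≤ γ₀ P)
    -- (J0′) THE INTRINSIC CONFIGURATION LETTER IN THE COMPACTNESS ROUTE's OUTPUT SHAPE (dag-n12-c g17 §4 `hMinC`; produced by dag-n12-w1's `hMin_of_localCharts` ∕ `hMin_of_criticalFamilies`
    -- lineage at `Kc :=` the closed guard): per run and instance, for EVERY COMPACT SET `Kc` of base fields inside the CLOSED small-field guard, ONE radius `R > 0` with the three clauses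
    (hMinC : ∀ P i (Kc : Set (GaugeField (F.P P.K) (k P i) SU2)), IsCompact Kc →
      (∀ Vk ∈ Kc, ∀ p ∈ plaqsInside (pts (k P i) (Z P i ∩ (Λ P i)ᶜ)), dist1 (GaugeField.plaqHol Vk p) ≤ eR P i) →
      ∃ R : ℝ, 0 < R ∧ ∀ Vk ∈ Kc,
      ∃ Ũ : VecField (F.P P.K) (k P i) (EuclideanSpace ℂ (Fin 3)) × VecField (F.P P.K) (k P i) (EuclideanSpace ℂ (Fin 3)) →
          PBond (F.P P.K) 0 → Matrix (Fin 2) (Fin 2) ℂ,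
        (∀ b a c, DifferentiableOn ℂ (fun z => Ũ z b a c) (ball 0 R)) ∧
        (∀ z ∈ ball (0 : VecField (F.P P.K) (k P i) (EuclideanSpace ℂ (Fin 3)) × VecField (F.P P.K) (k P i) (EuclideanSpace ℂ (Fin 3))) R,
          ∀ b a c, ‖Ũ z b a c‖ ≤ 𝓐₀ P i) ∧
        ∀ p B' : VecField (F.P P.K) (k P i) E3, ‖p‖ < R → ‖B'‖ < R → ∃ U' : GaugeField (F.P P.K) 0 SU2,
          (∀ b, Ũ (cplxVec p, cplxVec B') b = ((U' b : SU2) : Matrix (Fin 2) (Fin 2) ℂ)) ∧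
            IsMinimizer (avOfRecord F 2 P.K) (regMSCoPOfRecord F 2 Θ.ν P.K (k P i) (maxDomT Θ.ν.M₁ (Z P i))) (Bj Θ.ν.M₁ (Z P i) (k P i))
              (avgFamily (avOfRecord F 2 P.K) (qsstarGIter0 (k P i) (expMul su2Chart B' (ext P i (expMul su2Chart p Vk))))) U')
    -- (N) THE NEAR-FLAT LETTER PACKAGE per instance and per base field in the STRICT guard (replaces (L2) `h17`)
    {δc μc ρc δ₂c Kc τc : ∀ P : B12.RunParams, ι P → ℝ} (hδc0 : ∀ P i, 0 ≤ δc P i) (hμc0 : ∀ P i, 0 ≤ μc P i) (hρc0 : ∀ P i, 0 ≤ ρc P i) (hδ₂c0 : ∀ P i, 0 ≤ δ₂c P i)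
    (hNF : ∀ P i (Vk : GaugeField (F.P P.K) (k P i) SU2), PlaqSmallOn (plaqsInside (pts (k P i) (Z P i ∩ (Λ P i)ᶜ))) (eR P i) Vk →
      ∃ (U₀ : GaugeField (F.P P.K) 0 SU2) (Xf : GaugeSlice (pts (k P i) (Λ P i)) (T P i) E3 → PBond (F.P P.K) 0 → lieSU (Fin 2)),
        (∀ p : Plaq (F.P P.K) 0, ((⟨p.src, p.μ⟩ : PBond (F.P P.K) 0) ∈ {b : PBond (F.P P.K) 0 | b.src ∈ maxDomT Θ.ν.M₁ (Z P i) 1} ∨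
            (⟨p.src.shift p.μ, p.ν⟩ : PBond (F.P P.K) 0) ∈ {b : PBond (F.P P.K) 0 | b.src ∈ maxDomT Θ.ν.M₁ (Z P i) 1} ∨
            (⟨p.src.shift p.ν, p.μ⟩ : PBond (F.P P.K) 0) ∈ {b : PBond (F.P P.K) 0 | b.src ∈ maxDomT Θ.ν.M₁ (Z P i) 1} ∨
            (⟨p.src, p.ν⟩ : PBond (F.P P.K) 0) ∈ {b : PBond (F.P P.K) 0 | b.src ∈ maxDomT Θ.ν.M₁ (Z P i) 1}) →
          ‖((U₀ ⟨p.src, p.μ⟩ : SU2) : Matrix (Fin 2) (Fin 2) ℂ) - 1‖ ≤ δc P i ∧ ‖((U₀ ⟨p.src.shift p.μ, p.ν⟩ : SU2) : Matrix (Fin 2) (Fin 2) ℂ) - 1‖ ≤ δc P i ∧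
            ‖((U₀ ⟨p.src.shift p.ν, p.μ⟩ : SU2) : Matrix (Fin 2) (Fin 2) ℂ) - 1‖ ≤ δc P i ∧ ‖((U₀ ⟨p.src, p.ν⟩ : SU2) : Matrix (Fin 2) (Fin 2) ℂ) - 1‖ ≤ δc P i) ∧
        Xf 0 = 0 ∧ ContDiffAt ℝ 2 Xf 0 ∧
        (∀ᶠ Y in 𝓝 (0 : GaugeSlice (pts (k P i) (Λ P i)) (T P i) E3),
          IsMinimizer (Node00.avOfRecord F 2 P.K) (Node00.regMSCoPOfRecord F 2 Θ.ν P.K (k P i) (maxDomT Θ.ν.M₁ (Z P i))) (Bj Θ.ν.M₁ (Z P i) (k P i))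
            (avgFamily (Node00.avOfRecord F 2 P.K) (qsstarGIter0 (k P i) (expMul su2Chart (ιA (pts (k P i) (Λ P i)) (T P i) Y) (ext P i Vk)))) (expChart U₀ (Xf Y))) ∧
        ∃ (Ψ₂ : (PBond (F.P P.K) 0 → lieSU (Fin 2)) →L[ℝ] (PBond (F.P P.K) 0 → lieSU (Fin 2)) →L[ℝ] (Fin (constrCard (Bj Θ.ν.M₁ (Z P i) (k P i)) (k P i)) → lieSU (Fin 2)))
          (lam : (Fin (constrCard (Bj Θ.ν.M₁ (Z P i) (k P i)) (k P i)) → lieSU (Fin 2)) →L[ℝ] ℝ)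
          (p : Seminorm ℝ (PBond (F.P P.K) 0 → lieSU (Fin 2))) (q : (Fin (constrCard (Bj Θ.ν.M₁ (Z P i) (k P i)) (k P i)) → lieSU (Fin 2)) → ℝ)
          (Lf : (PBond (F.P P.K) 0 → lieSU (Fin 2)) →L[ℝ] (Fin (constrCard (Bj Θ.ν.M₁ (Z P i) (k P i)) (k P i)) → lieSU (Fin 2)))
          (Rf : (Fin (constrCard (Bj Θ.ν.M₁ (Z P i) (k P i)) (k P i)) → lieSU (Fin 2)) → PBond (F.P P.K) 0 → lieSU (Fin 2)),
          HasFDerivAt (fun Y => fderiv ℝ (msChart F 2 P.K (k P i) (Bj Θ.ν.M₁ (Z P i) (k P i)) (avgFamily (Node00.avOfRecord F 2 P.K) (qsstarGIter0 (k P i) (ext P i Vk))) U₀) Y) Ψ₂ 0 ∧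
          (∀ᶠ Y in 𝓝 (0 : PBond (F.P P.K) 0 → lieSU (Fin 2)),
            DifferentiableAt ℝ (msChart F 2 P.K (k P i) (Bj Θ.ν.M₁ (Z P i) (k P i)) (avgFamily (Node00.avOfRecord F 2 P.K) (qsstarGIter0 (k P i) (ext P i Vk))) U₀) Y) ∧
          fderiv ℝ (fun Y : PBond (F.P P.K) 0 → lieSU (Fin 2) => wilsonAction4 (expChart U₀ Y)) 0 =
            lam.comp (fderiv ℝ (msChart F 2 P.K (k P i) (Bj Θ.ν.M₁ (Z P i) (k P i)) (avgFamily (Node00.avOfRecord F 2 P.K) (qsstarGIter0 (k P i) (ext P i Vk))) U₀) 0) ∧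
          (∀ Y : PBond (F.P P.K) 0 → lieSU (Fin 2), ∑ b, ‖(Y b : Matrix (Fin 2) (Fin 2) ℂ)‖ ^ 2 ≤ p Y ^ 2) ∧
          (∀ v, Lf (Rf v) = v) ∧ (∀ v, p (Rf v) ≤ ρc P i * q v) ∧
          ∀ X : GaugeSlice (pts (k P i) (Λ P i)) (T P i) E3,
            q (fderiv ℝ (msChart F 2 P.K (k P i) (Bj Θ.ν.M₁ (Z P i) (k P i)) (avgFamily (Node00.avOfRecord F 2 P.K) (qsstarGIter0 (k P i) (ext P i Vk))) U₀) 0 (fderiv ℝ Xf 0 X)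
                - Lf (fderiv ℝ Xf 0 X)) ≤ δ₂c P i * p (fderiv ℝ Xf 0 X) ∧
            lam (Ψ₂ (fderiv ℝ Xf 0 X) (fderiv ℝ Xf 0 X)) ≤ μc P i * p (fderiv ℝ Xf 0 X) ^ 2 ∧
            p (fderiv ℝ Xf 0 X) ≤ Kc P i * ‖X‖ ∧
            ∃ m : ℝ, (∀ w', Lf w' = fderiv ℝ (msChart F 2 P.K (k P i) (Bj Θ.ν.M₁ (Z P i) (k P i)) (avgFamily (Node00.avOfRecord F 2 P.K) (qsstarGIter0 (k P i) (ext P i Vk))) U₀) 0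
                  (fderiv ℝ Xf 0 X) →
                m ≤ fderiv ℝ (fun Y => fderiv ℝ (fun Y : PBond (F.P P.K) 0 → lieSU (Fin 2) => wilsonAction4 (expChart (1 : GaugeField (F.P P.K) 0 SU2) Y)) Y) 0 w' w') ∧
              γ₀ P * (∑ z ∈ box (fun κ => (hi P i κ - lo P i κ + 1).toNat + 3) (fun κ => lo P i κ - 2), ∑ μ : Fin (F.P P.K).d, ∑ a : Fin 3,
                  curl (fun b => ιA (pts (k P i) (Λ P i)) (T P i) X (⟨castSite b.1, b.2⟩ : PBond (F.P P.K) (k P i)) a) z ⟨0, h0 P⟩ μ ^ 2) - τc P i * ‖X‖ ^ 2 ≤ m)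
    -- numerics: the assembled `Cerr i` (with the twist defect `τc P i`) is small, and the positivity constant fits
    (hsm : ∀ P i, (32 * (((F.P P.K).d : ℝ) - 1) * δc P i + μc P i + 16 * (((F.P P.K).d : ℝ) - 1) * (ρc P i * δ₂c P i) * (2 + ρc P i * δ₂c P i)) * Kc P i ^ 2 + τc P i
      ≤ γ₀ P / (2 * (3 * (Kb P i : ℝ) ^ 2 + 2 * (Kb P i : ℝ) ^ 4)))
    (hγle : ∀ P i, γ P / (M P i) ^ 5 ≤ γ₀ P / (2 * (3 * (Kb P i : ℝ) ^ 2 + 2 * (Kb P i : ℝ) ^ 4)))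
    -- the geometric letter: every fine site whose k-block label lies in the box `[lo − 1, hi + 1]` lies in `Ω₁(Z)` (print: `Λ` deep inside `Z`); dag-n12-c's `far_letter_of_box` turns it into the bond letter `hfar`
    (hZ1 : ∀ P i (y : Site (F.P P.K) 0), B14.Eq22Determines.blockIter (k P i) y ∈ (castSite '' Set.Icc (lo P i - 1) (hi P i + 1) : Set (Site (F.P P.K) (k P i))) → y ∈ maxDomT Θ.ν.M₁ (Z P i) 1)
    -- (Gᵃ) `Z` a union of `k`-blocks (print's `Z` is a union of `M`-cubes of `T₁^{(k)}`)
    (hZblk : ∀ P i, B14.Eq22Determines.IsBlockUnion (k P i) (Z P i))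
    -- (Gᵇ) DISCHARGED (dag-n12-c §8): print's `M₁ ≥ 2` and, per instance, the torus divisibility `L^{k}·M₁ ∣ 2L^{m+K}` of the `LʲM₁`-cube partitions
    (hM2 : 2 ≤ Θ.ν.M₁) (hdiv : ∀ P i, B14.Eq213MaximalDomains.side (F.P P.K).L Θ.ν.M₁ (k P i) ∣ (F.P P.K).sitesPerDir 0)
    -- bookkeeping constants: `c_E`, `c_A` per run; `B₃`, `a₀`, `a₁'` = THE [15] THEOREM-1 CONSTANTS OF (8) (one triple for all runs and instances)
    {cE cA : B12.RunParams → ℝ} {B₃ a₀ a₁' : ℝ} (hcE0 : ∀ P, 0 ≤ cE P) (hcE : ∀ P i, 12 * ((F.P P.K).d : ℝ) * ((n P i : ℝ) + 2) ^ 2 ≤ cE P) (hB₃ : 0 ≤ B₃)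
    (heRa : ∀ P i, (cE P + 1) * eR P i ≤ a₁' ∧ B₃ * ((cE P + 1) * eR P i) ≤ Θ.ν.εreg) (ha₀ : Θ.ν.εreg ≤ a₀)
    (hcA : ∀ P, 1 / 2 * (B₃ * (cE P + 1) * (F.P P.K).eta 1 ^ 2) ^ 2 * (Fintype.card (Plaq (F.P P.K) 0) : ℝ) ≤ cA P)
    -- [15] THEOREM 1 (R) = NODE 00's NAMED FACT (8) `VariationalThm1RegSepCoP7M` — K0⁷'s letter (plan g76 V15 stub 1's consequence by dag-n07-e's bridge) — ONE hypothesis for all runs and instances;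
    -- §0 reads it at the degenerate history `(M, g) := (ν.M₁, 1)` as dag-n12-c's torus-class letter `h15T` at every `(Θ.ν, P.K)`
    (h15 : VariationalThm1RegSepCoP7M F 2 B₃ a₀ a₁') :
    ∃ R areg : ∀ P : B12.RunParams, ι P → ℝ, (∀ P i, 0 < R P i) ∧ (∀ P i, 0 < areg P i) ∧
      ∀ P : B12.RunParams, lam.kSel P < P.K →
        B15Leaf (WOfRecord₁₃ F 2 (Θ.liveRepin₁₃ F 2)
          { lam with LF := fun P => lfVarOn su2Chart fun i => InstOn.std (bgMSCoPOfRecord F 2 Θ.ν P.K (k P i) (maxDomT Θ.ν.M₁ (Z P i))) Θ.ν.M₁ (Z P i) (Λ P i) (k P i) (M P i) (areg P i)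
                            (anExt (pts (k P i) (Λ P i)) (T P i) (fun177std (bgMSCoPOfRecord F 2 Θ.ν P.K (k P i) (maxDomT Θ.ν.M₁ (Z P i))) Θ.ν.M₁ (Z P i) (k P i)) (ext P i)
                              (min (1 / 2) (min (R P i / 8) (γ P / (M P i) ^ 5 * (R P i / 2) ^ 2 /
                                (48 * (4 * ((Fintype.card (Plaq (F.P P.K) 0) : ℝ) * (1 + 8 * 𝓐₀ P i ^ 4)) / R P i + 1)))))) } P) := by
  choose R hR areg ha hP using fun P : B12.RunParams =>
    exists_domain_prop1Printed_lfVarOn_std_su2_box_intrinsic_analytic_atZSeqCoPRecord_ofThm1TorusClass_ofMinimiserFamilyCompact_ofNearFlatLetters_sub_loc_oneSided (F := F) Θ.ν P.K (hd3 P) (h0 P)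
      (Z := Z P) (Λ := Λ P) (k := k P) (M := M P) (hk0 := hk0 P) (hk := hk P) (eR := eR P) (heR := heR P) (T := T P) (lo := lo P) (hi := hi P) (n := n P) (hn := hn P)
      (hN := hN P) (hbox := hbox P) (hZ := hZ P) (hTG0 := hTG0 P) (hN5 := hN5 P) (K := Kb P) (hK1 := hK1 P) (hKn := hKn P) (ext := ext P) (hext := hext P) (hlohi := hlohi P)
      (hγ := hγ P) (hbx := hbx P) (hbxM := hbxM P) (hM := hM P) (hγ₀ := hγ₀ P) (hMinC := hMinC P) (hδc0 := hδc0 P) (hμc0 := hμc0 P) (hρc0 := hρc0 P) (hδ₂c0 := hδ₂c0 P) (hNF := hNF P)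
      (hsm := hsm P) (hγle := hγle P) (hfar := fun i b hb => far_letter_of_box (hbox P i) (hZ1 P i) b hb) (hZblk := hZblk P) (hM2 := hM2) (hdiv := hdiv P)
      (hcE0 := hcE0 P) (hcE := hcE P) (hB₃ := hB₃) (heRa := heRa P) (ha₀ := ha₀) (hcA := hcA P)
      (h15T := thm1TorusClass_of_variationalThm1RegSepCoP7M Θ.ν P.K h15)
  refine ⟨R, areg, hR, ha, fun P hkP => ?_⟩
  apply b15Leaf_WOfRecord₁₃_liveRepin₁₃_of_massLive_of_hasResiduals Θ _ hres (P := P)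
  · exact hkP
  · exact hpin P hkP
  · exact hmassLive P hkP
  · exact hP P
  · exact h180 P hkP
  · exact h189 P hkP

end RecordAtZSeqNearFlat

/-! ## §2 At the GENERIC WINDOW-EDITION WITNESS `θ₁₅ᶜᶜᴹᵂ(j;γ;ε₀,ε₂₉;B₃,B₃',a₀,a₁)` of the V19 door: the [15] input IS the door letter `h15`, (L2) from the LOCALISED package (N) -/

section AtThm1CCMW
variable (j : ℕ) (γ ε₀ ε₂₉ B₃ B₃' a₀ a₁ : ℝ) (lam : ResidW F 2)

/-- **★★★★ THE SAME ROW AT THE GENERIC WINDOW-EDITION WITNESS `θ₁₅ᶜᶜᴹᵂ(j;γ;ε₀,ε₂₉;B₃,B₃',a₀,a₁)` OF THE V19 DOOR, (L2) FROM THE LOCALISED PACKAGE (N) (J-C v1.2), THE [15] INPUT BEING THE DOOR LETTER `h15`** (§1 at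
`Θ := theta13OfNumerics … (stage12NumericsOfThm1CCMW F.L j γ ε₀ B₃ B₃' a₀ a₁) …`, ₁₃ live re-pin = `θ₁₅ᶜᶜᴹᵂ(j;γ;…)` by `rfl`; `2 ≤ M₁ = L^j` from `1 ≤ j`, `ν.εreg = a₀` by `rfl`): EXACTLY TWO of
dag-n24-c's fifteen door letters are read (`hB : 0 ≤ B₃`, `h15`) + `1 ≤ j`; displayed per run ∕ instance: (J0′) `hMinC`, (N) `hNF` + signs + `hsm`∕`hγle`, (Gᵃ), `hdiv`, `hZ1`, `hk0`∕`hk`, box data,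
`[Finite (ι P)]`, and N12's per-run displays below the torus.  = the Proposition-1 conjunct of `…GenericDoorV19` §3's raw row `h12P1F` at this witness with Prop. 1 PROVED from the w-wave's
assembled letter list (12Zᴳ ∘ this = N12's `h12F` row modulo (J0′) + (N) + geometry + live-mass + (1.80)∕(1.89) + `hdeg`).  Count-neutral; NOT a discharge of N12; K0⁷ ∕ K1⁷ NOT closed. [cite: Balaban1989LargeFieldI, (0.2)–(0.6) p.176, (1.74) p.192, p.193 ll.14–20, Prop. 1 (1.77)–(1.78) p.194, (1.79)–(1.80) p.195, (1.89) p.198, (1.99)–(1.102) pp.200–201; Balaban1989LargeFieldII, (1.7)–(1.9) p.358, (1.11)–(1.13) p.359, (17)–(19) pp.360–361; Balaban1988Convergent, (2.1) p.254, (2.4)–(2.5) p.255, (2.12)–(2.14) pp.256–257, (3.16) p.268, (3.22)–(3.25) pp.269–270; Balaban1985RegularSpaces, (1.3)–(1.6) p.77 (witness letter); Balaban1985Variational, Thm 1 (8) p.279, Prop. 9 (190) p.309; Balaban1987RG1, Thm 1 p.259 (bookkeeping)] -/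
theorem exists_radius_pinLF_b15Leaf_WOfRecord₁₃_theta13OfThm1CCMW_of_massLive_of_variationalThm1RegSepCoP7M_atZSeqCoPRecord_nearFlatLoc (hj : 1 ≤ j)
    -- N12's displays at the letters `kSel ∕ D189 ∕ D1100` of `λ`, run by run, BELOW THE TORUS
    (hpin : ∀ P : B12.RunParams, lam.kSel P < P.K → lam.D1100 P
      = rPrimeDataOfSel (reprTOfRecord₁₃ F 2 (theta13OfThm1CCMW F 2 j γ ε₀ ε₂₉ B₃ B₃' a₀ a₁) P (lam.kSel P))
          ((theta13OfThm1CCMW F 2 j γ ε₀ ε₂₉ B₃ B₃' a₀ a₁).ppSel P (gOfRecord₁₃ F 2 (theta13OfThm1CCMW F 2 j γ ε₀ ε₂₉ B₃ B₃' a₀ a₁) P) (lam.kSel P + 1))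
          (fibOfSeq F (theta13OfThm1CCMW F 2 j γ ε₀ ε₂₉ B₃ B₃' a₀ a₁).ν (theta13OfThm1CCMW F 2 j γ ε₀ ε₂₉ B₃ B₃' a₀ a₁).τ9 P (gOfRecord₁₃ F 2 (theta13OfThm1CCMW F 2 j γ ε₀ ε₂₉ B₃ B₃' a₀ a₁) P) (lam.kSel P + 1)))
    (hmassLive : ∀ P : B12.RunParams, lam.kSel P < P.K → ∀ s, LiveSeq F 2 (theta13OfThm1CCMW F 2 j γ ε₀ ε₂₉ B₃ B₃' a₀ a₁).ν (theta13OfThm1CCMW F 2 j γ ε₀ ε₂₉ B₃ B₃' a₀ a₁).τ9 P (gOfRecord₁₃ F 2 (theta13OfThm1CCMW F 2 j γ ε₀ ε₂₉ B₃ B₃' a₀ a₁) P) (lam.kSel P + 1)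
        (slotsTOfRecord F 2 (theta13OfThm1CCMW F 2 j γ ε₀ ε₂₉ B₃ B₃' a₀ a₁).ν (theta13OfThm1CCMW F 2 j γ ε₀ ε₂₉ B₃ B₃' a₀ a₁).τ9 (EOfRecord₁₃ F 2 (theta13OfThm1CCMW F 2 j γ ε₀ ε₂₉ B₃ B₃' a₀ a₁)) (wOfRecord₉ F 2 (theta13OfThm1CCMW F 2 j γ ε₀ ε₂₉ B₃ B₃' a₀ a₁).toStage9Params)
          (theta13OfThm1CCMW F 2 j γ ε₀ ε₂₉ B₃ B₃' a₀ a₁).ppSel P (gOfRecord₁₃ F 2 (theta13OfThm1CCMW F 2 j γ ε₀ ε₂₉ B₃ B₃' a₀ a₁) P) (lam.kSel P + 1)) s →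
      0 < ∫ V, rterm (reprTOfRecord₁₃ F 2 (theta13OfThm1CCMW F 2 j γ ε₀ ε₂₉ B₃ B₃' a₀ a₁) P (lam.kSel P)) s V ∂(fieldMeasure (F.P P.K) (lam.kSel P + 1) (SU 2)))
    (h180 : ∀ P : B12.RunParams, lam.kSel P < P.K → ∀ U, new189 (lam.D189 P) U → ∀ i, (lam.D189 P).h ≤ i → i ≤ (lam.D189 P).k →
      ∀ q ∈ plaqsOf (dom (lam.D189 P) i),
        Ineq180 ((lam.D189 P).dev0 U q) ((lam.D189 P).ε (lam.D189 P).k) (lam.D189 P).η (lam.D189 P).B₃ (lam.D189 P).B₅ (lam.D189 P).M (lam.D189 P).δ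
          ((lam.D189 P).dist q) (lam.D189 P).O1)
    (h189 : ∀ P : B12.RunParams, lam.kSel P < P.K → Claim189 (new189 (lam.D189 P)) (chiPP (lam.D189 P)))
    -- dag-n12-c's Proposition-1 instance data ON THE RUN's LATTICE `F.P P.K`, per run `P` and instance `i : ι P` (structural ∕ constants, exactly as in its endpoint of record)
    (hd3 : ∀ P : B12.RunParams, 3 ≤ (F.P P.K).d) (h0 : ∀ P : B12.RunParams, 0 < (F.P P.K).d) (ι : B12.RunParams → Type)
    [hfin : ∀ P : B12.RunParams, Finite (ι P)]
    -- NO background letters: per instance the class is that of `Z P i`'s OWN maximal sequence `maxDomT (theta13OfThm1CCMW F 2 j γ ε₀ ε₂₉ B₃ B₃' a₀ a₁).ν.M₁ (Z P i)` up to scale `k P i` (dag-n12-c LOCATED-CLASS)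
    (Z Λ : ∀ P : B12.RunParams, ι P → Set (Site (F.P P.K) 0))
    (k : ∀ P : B12.RunParams, ι P → ℕ) (M : ∀ P : B12.RunParams, ι P → ℝ) (hk0 : ∀ P i, 0 < k P i) (hk : ∀ P i, k P i ≤ (F.P P.K).m + (F.P P.K).K)
    (eR : ∀ P : B12.RunParams, ι P → ℝ) (heR : ∀ P i, 0 < eR P i)
    (T : ∀ (P : B12.RunParams) (i : ι P), Finset (PBond (F.P P.K) (k P i)))
    (lo hi : ∀ P : B12.RunParams, ι P → Fin (F.P P.K).d → ℤ) (n : ∀ P : B12.RunParams, ι P → ℕ) (hn : ∀ P i κ, hi P i κ ≤ lo P i κ + n P i)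
    (hN : ∀ P i, n P i + 2 < (F.P P.K).sitesPerDir (k P i))
    (hbox : ∀ P i, pts (k P i) (Λ P i) = (castSite '' Set.Icc (lo P i) (hi P i) : Set (Site (F.P P.K) (k P i))))
    (hZ : ∀ P i, (boxPlaqs (lo P i - 1) (hi P i + 1) : Set (Plaq (F.P P.K) (k P i))) ⊆ plaqsInside (pts (k P i) (Z P i)))
    (hTG0 : ∀ P i, T P i = (box (fun κ => (hi P i κ - lo P i κ + 1).toNat) (lo P i)).image fun x =>
      (⟨castSite (x - unitVec ⟨0, h0 P⟩), ⟨0, h0 P⟩⟩ : PBond (F.P P.K) (k P i)))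
    (hN5 : ∀ P i κ, ((hi P i κ - lo P i κ + 1).toNat : ℤ) + 5 < (F.P P.K).sitesPerDir (k P i))
    (Kb : ∀ P : B12.RunParams, ι P → ℕ) (hK1 : ∀ P i, 1 ≤ Kb P i) (hKn : ∀ P i κ, (hi P i κ - lo P i κ + 1).toNat ≤ Kb P i)
    (ext : ∀ (P : B12.RunParams) (i : ι P), GaugeField (F.P P.K) (k P i) SU2 → GaugeField (F.P P.K) (k P i) SU2)
    (hext : ∀ P i Vk, ext P i Vk = extend (pts (k P i) (Λ P i)) (shellGauge Vk (lo P i) (hi P i)) Vk)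
    (hlohi : ∀ P i, lo P i ≤ hi P i)
    {γ₈ bx : B12.RunParams → ℝ} (hγ : ∀ P, 0 < γ₈ P) (hbx : ∀ P, 0 ≤ bx P)
    (hbxM : ∀ P i, 12 * ((F.P P.K).d : ℝ) * ((n P i : ℝ) + 2) ^ 2 ≤ bx P * (M P i) ^ 2)
    {𝓐₀ : ∀ P : B12.RunParams, ι P → ℝ} (hM : ∀ P i, 1 ≤ M P i)
    {γ₀ : B12.RunParams → ℝ} (hγ₀ : ∀ P, 0 ≤ γ₀ P)
    -- (J0′) THE INTRINSIC CONFIGURATION LETTER IN THE COMPACTNESS ROUTE's OUTPUT SHAPE (dag-n12-c g17 §4 `hMinC`; produced by dag-n12-w1's `hMin_of_localCharts` ∕ `hMin_of_criticalFamilies`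
    -- lineage at `Kc :=` the closed guard): per run and instance, for EVERY COMPACT SET `Kc` of base fields inside the CLOSED small-field guard, ONE radius `R > 0` with the three clauses
    (hMinC : ∀ P i (Kc : Set (GaugeField (F.P P.K) (k P i) SU2)), IsCompact Kc →
      (∀ Vk ∈ Kc, ∀ p ∈ plaqsInside (pts (k P i) (Z P i ∩ (Λ P i)ᶜ)), dist1 (GaugeField.plaqHol Vk p) ≤ eR P i) →
      ∃ R : ℝ, 0 < R ∧ ∀ Vk ∈ Kc,
      ∃ Ũ : VecField (F.P P.K) (k P i) (EuclideanSpace ℂ (Fin 3)) × VecField (F.P P.K) (k P i) (EuclideanSpace ℂ (Fin 3)) →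
          PBond (F.P P.K) 0 → Matrix (Fin 2) (Fin 2) ℂ,
        (∀ b a c, DifferentiableOn ℂ (fun z => Ũ z b a c) (ball 0 R)) ∧
        (∀ z ∈ ball (0 : VecField (F.P P.K) (k P i) (EuclideanSpace ℂ (Fin 3)) × VecField (F.P P.K) (k P i) (EuclideanSpace ℂ (Fin 3))) R,
          ∀ b a c, ‖Ũ z b a c‖ ≤ 𝓐₀ P i) ∧
        ∀ p B' : VecField (F.P P.K) (k P i) E3, ‖p‖ < R → ‖B'‖ < R → ∃ U' : GaugeField (F.P P.K) 0 SU2,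
          (∀ b, Ũ (cplxVec p, cplxVec B') b = ((U' b : SU2) : Matrix (Fin 2) (Fin 2) ℂ)) ∧
            IsMinimizer (avOfRecord F 2 P.K) (regMSCoPOfRecord F 2 (theta13OfThm1CCMW F 2 j γ ε₀ ε₂₉ B₃ B₃' a₀ a₁).ν P.K (k P i) (maxDomT (theta13OfThm1CCMW F 2 j γ ε₀ ε₂₉ B₃ B₃' a₀ a₁).ν.M₁ (Z P i))) (Bj (theta13OfThm1CCMW F 2 j γ ε₀ ε₂₉ B₃ B₃' a₀ a₁).ν.M₁ (Z P i) (k P i))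
              (avgFamily (avOfRecord F 2 P.K) (qsstarGIter0 (k P i) (expMul su2Chart B' (ext P i (expMul su2Chart p Vk))))) U')
    -- (N) THE NEAR-FLAT LETTER PACKAGE per instance and per base field in the STRICT guard (replaces (L2) `h17`)
    {δc μc ρc δ₂c Kc τc : ∀ P : B12.RunParams, ι P → ℝ} (hδc0 : ∀ P i, 0 ≤ δc P i) (hμc0 : ∀ P i, 0 ≤ μc P i) (hρc0 : ∀ P i, 0 ≤ ρc P i) (hδ₂c0 : ∀ P i, 0 ≤ δ₂c P i)
    (hNF : ∀ P i (Vk : GaugeField (F.P P.K) (k P i) SU2), PlaqSmallOn (plaqsInside (pts (k P i) (Z P i ∩ (Λ P i)ᶜ))) (eR P i) Vk →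
      ∃ (U₀ : GaugeField (F.P P.K) 0 SU2) (Xf : GaugeSlice (pts (k P i) (Λ P i)) (T P i) E3 → PBond (F.P P.K) 0 → lieSU (Fin 2)),
        (∀ p : Plaq (F.P P.K) 0, ((⟨p.src, p.μ⟩ : PBond (F.P P.K) 0) ∈ {b : PBond (F.P P.K) 0 | b.src ∈ maxDomT (theta13OfThm1CCMW F 2 j γ ε₀ ε₂₉ B₃ B₃' a₀ a₁).ν.M₁ (Z P i) 1} ∨
            (⟨p.src.shift p.μ, p.ν⟩ : PBond (F.P P.K) 0) ∈ {b : PBond (F.P P.K) 0 | b.src ∈ maxDomT (theta13OfThm1CCMW F 2 j γ ε₀ ε₂₉ B₃ B₃' a₀ a₁).ν.M₁ (Z P i) 1} ∨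
            (⟨p.src.shift p.ν, p.μ⟩ : PBond (F.P P.K) 0) ∈ {b : PBond (F.P P.K) 0 | b.src ∈ maxDomT (theta13OfThm1CCMW F 2 j γ ε₀ ε₂₉ B₃ B₃' a₀ a₁).ν.M₁ (Z P i) 1} ∨
            (⟨p.src, p.ν⟩ : PBond (F.P P.K) 0) ∈ {b : PBond (F.P P.K) 0 | b.src ∈ maxDomT (theta13OfThm1CCMW F 2 j γ ε₀ ε₂₉ B₃ B₃' a₀ a₁).ν.M₁ (Z P i) 1}) →
          ‖((U₀ ⟨p.src, p.μ⟩ : SU2) : Matrix (Fin 2) (Fin 2) ℂ) - 1‖ ≤ δc P i ∧ ‖((U₀ ⟨p.src.shift p.μ, p.ν⟩ : SU2) : Matrix (Fin 2) (Fin 2) ℂ) - 1‖ ≤ δc P i ∧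
            ‖((U₀ ⟨p.src.shift p.ν, p.μ⟩ : SU2) : Matrix (Fin 2) (Fin 2) ℂ) - 1‖ ≤ δc P i ∧ ‖((U₀ ⟨p.src, p.ν⟩ : SU2) : Matrix (Fin 2) (Fin 2) ℂ) - 1‖ ≤ δc P i) ∧
        Xf 0 = 0 ∧ ContDiffAt ℝ 2 Xf 0 ∧
        (∀ᶠ Y in 𝓝 (0 : GaugeSlice (pts (k P i) (Λ P i)) (T P i) E3),
          IsMinimizer (Node00.avOfRecord F 2 P.K) (Node00.regMSCoPOfRecord F 2 (theta13OfThm1CCMW F 2 j γ ε₀ ε₂₉ B₃ B₃' a₀ a₁).ν P.K (k P i) (maxDomT (theta13OfThm1CCMW F 2 j γ ε₀ ε₂₉ B₃ B₃' a₀ a₁).ν.M₁ (Z P i))) (Bj (theta13OfThm1CCMW F 2 j γ ε₀ ε₂₉ B₃ B₃' a₀ a₁).ν.M₁ (Z P i) (k P i))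
            (avgFamily (Node00.avOfRecord F 2 P.K) (qsstarGIter0 (k P i) (expMul su2Chart (ιA (pts (k P i) (Λ P i)) (T P i) Y) (ext P i Vk)))) (expChart U₀ (Xf Y))) ∧
        ∃ (Ψ₂ : (PBond (F.P P.K) 0 → lieSU (Fin 2)) →L[ℝ] (PBond (F.P P.K) 0 → lieSU (Fin 2)) →L[ℝ] (Fin (constrCard (Bj (theta13OfThm1CCMW F 2 j γ ε₀ ε₂₉ B₃ B₃' a₀ a₁).ν.M₁ (Z P i) (k P i)) (k P i)) → lieSU (Fin 2)))
          (lam : (Fin (constrCard (Bj (theta13OfThm1CCMW F 2 j γ ε₀ ε₂₉ B₃ B₃' a₀ a₁).ν.M₁ (Z P i) (k P i)) (k P i)) → lieSU (Fin 2)) →L[ℝ] ℝ)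
          (p : Seminorm ℝ (PBond (F.P P.K) 0 → lieSU (Fin 2))) (q : (Fin (constrCard (Bj (theta13OfThm1CCMW F 2 j γ ε₀ ε₂₉ B₃ B₃' a₀ a₁).ν.M₁ (Z P i) (k P i)) (k P i)) → lieSU (Fin 2)) → ℝ)
          (Lf : (PBond (F.P P.K) 0 → lieSU (Fin 2)) →L[ℝ] (Fin (constrCard (Bj (theta13OfThm1CCMW F 2 j γ ε₀ ε₂₉ B₃ B₃' a₀ a₁).ν.M₁ (Z P i) (k P i)) (k P i)) → lieSU (Fin 2)))
          (Rf : (Fin (constrCard (Bj (theta13OfThm1CCMW F 2 j γ ε₀ ε₂₉ B₃ B₃' a₀ a₁).ν.M₁ (Z P i) (k P i)) (k P i)) → lieSU (Fin 2)) → PBond (F.P P.K) 0 → lieSU (Fin 2)),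
          HasFDerivAt (fun Y => fderiv ℝ (msChart F 2 P.K (k P i) (Bj (theta13OfThm1CCMW F 2 j γ ε₀ ε₂₉ B₃ B₃' a₀ a₁).ν.M₁ (Z P i) (k P i)) (avgFamily (Node00.avOfRecord F 2 P.K) (qsstarGIter0 (k P i) (ext P i Vk))) U₀) Y) Ψ₂ 0 ∧
          (∀ᶠ Y in 𝓝 (0 : PBond (F.P P.K) 0 → lieSU (Fin 2)),
            DifferentiableAt ℝ (msChart F 2 P.K (k P i) (Bj (theta13OfThm1CCMW F 2 j γ ε₀ ε₂₉ B₃ B₃' a₀ a₁).ν.M₁ (Z P i) (k P i)) (avgFamily (Node00.avOfRecord F 2 P.K) (qsstarGIter0 (k P i) (ext P i Vk))) U₀) Y) ∧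
          fderiv ℝ (fun Y : PBond (F.P P.K) 0 → lieSU (Fin 2) => wilsonAction4 (expChart U₀ Y)) 0 =
            lam.comp (fderiv ℝ (msChart F 2 P.K (k P i) (Bj (theta13OfThm1CCMW F 2 j γ ε₀ ε₂₉ B₃ B₃' a₀ a₁).ν.M₁ (Z P i) (k P i)) (avgFamily (Node00.avOfRecord F 2 P.K) (qsstarGIter0 (k P i) (ext P i Vk))) U₀) 0) ∧
          (∀ Y : PBond (F.P P.K) 0 → lieSU (Fin 2), ∑ b, ‖(Y b : Matrix (Fin 2) (Fin 2) ℂ)‖ ^ 2 ≤ p Y ^ 2) ∧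
          (∀ v, Lf (Rf v) = v) ∧ (∀ v, p (Rf v) ≤ ρc P i * q v) ∧
          ∀ X : GaugeSlice (pts (k P i) (Λ P i)) (T P i) E3,
            q (fderiv ℝ (msChart F 2 P.K (k P i) (Bj (theta13OfThm1CCMW F 2 j γ ε₀ ε₂₉ B₃ B₃' a₀ a₁).ν.M₁ (Z P i) (k P i)) (avgFamily (Node00.avOfRecord F 2 P.K) (qsstarGIter0 (k P i) (ext P i Vk))) U₀) 0 (fderiv ℝ Xf 0 X)
                - Lf (fderiv ℝ Xf 0 X)) ≤ δ₂c P i * p (fderiv ℝ Xf 0 X) ∧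
            lam (Ψ₂ (fderiv ℝ Xf 0 X) (fderiv ℝ Xf 0 X)) ≤ μc P i * p (fderiv ℝ Xf 0 X) ^ 2 ∧
            p (fderiv ℝ Xf 0 X) ≤ Kc P i * ‖X‖ ∧
            ∃ m : ℝ, (∀ w', Lf w' = fderiv ℝ (msChart F 2 P.K (k P i) (Bj (theta13OfThm1CCMW F 2 j γ ε₀ ε₂₉ B₃ B₃' a₀ a₁).ν.M₁ (Z P i) (k P i)) (avgFamily (Node00.avOfRecord F 2 P.K) (qsstarGIter0 (k P i) (ext P i Vk))) U₀) 0
                  (fderiv ℝ Xf 0 X) →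
                m ≤ fderiv ℝ (fun Y => fderiv ℝ (fun Y : PBond (F.P P.K) 0 → lieSU (Fin 2) => wilsonAction4 (expChart (1 : GaugeField (F.P P.K) 0 SU2) Y)) Y) 0 w' w') ∧
              γ₀ P * (∑ z ∈ box (fun κ => (hi P i κ - lo P i κ + 1).toNat + 3) (fun κ => lo P i κ - 2), ∑ μ : Fin (F.P P.K).d, ∑ a : Fin 3,
                  curl (fun b => ιA (pts (k P i) (Λ P i)) (T P i) X (⟨castSite b.1, b.2⟩ : PBond (F.P P.K) (k P i)) a) z ⟨0, h0 P⟩ μ ^ 2) - τc P i * ‖X‖ ^ 2 ≤ m)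
    -- numerics: the assembled `Cerr i` (with the twist defect `τc P i`) is small, and the positivity constant fits
    (hsm : ∀ P i, (32 * (((F.P P.K).d : ℝ) - 1) * δc P i + μc P i + 16 * (((F.P P.K).d : ℝ) - 1) * (ρc P i * δ₂c P i) * (2 + ρc P i * δ₂c P i)) * Kc P i ^ 2 + τc P i
      ≤ γ₀ P / (2 * (3 * (Kb P i : ℝ) ^ 2 + 2 * (Kb P i : ℝ) ^ 4)))
    (hγle : ∀ P i, γ₈ P / (M P i) ^ 5 ≤ γ₀ P / (2 * (3 * (Kb P i : ℝ) ^ 2 + 2 * (Kb P i : ℝ) ^ 4)))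
    -- the geometric letter: every fine site whose k-block label lies in the box `[lo − 1, hi + 1]` lies in `Ω₁(Z)` (print: `Λ` deep inside `Z`); dag-n12-c's `far_letter_of_box` turns it into the bond letter `hfar`
    (hZ1 : ∀ P i (y : Site (F.P P.K) 0), B14.Eq22Determines.blockIter (k P i) y ∈ (castSite '' Set.Icc (lo P i - 1) (hi P i + 1) : Set (Site (F.P P.K) (k P i))) → y ∈ maxDomT (theta13OfThm1CCMW F 2 j γ ε₀ ε₂₉ B₃ B₃' a₀ a₁).ν.M₁ (Z P i) 1)
    -- (Gᵃ) `Z` a union of `k`-blocks (print's `Z` is a union of `M`-cubes of `T₁^{(k)}`)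
    (hZblk : ∀ P i, B14.Eq22Determines.IsBlockUnion (k P i) (Z P i))
    -- (Gᵇ) DISCHARGED (dag-n12-c §8): print's `M₁ ≥ 2` and, per instance, the torus divisibility `L^{k}·M₁ ∣ 2L^{m+K}` of the `LʲM₁`-cube partitions
    (hdiv : ∀ P i, B14.Eq213MaximalDomains.side (F.P P.K).L (theta13OfThm1CCMW F 2 j γ ε₀ ε₂₉ B₃ B₃' a₀ a₁).ν.M₁ (k P i) ∣ (F.P P.K).sitesPerDir 0)
    -- bookkeeping constants: `c_E`, `c_A` per run; `B₃`, `a₀`, `a₁'` = THE [15] THEOREM-1 CONSTANTS OF (8) (one triple for all runs and instances)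
    {cE cA : B12.RunParams → ℝ} (hcE0 : ∀ P, 0 ≤ cE P) (hcE : ∀ P i, 12 * ((F.P P.K).d : ℝ) * ((n P i : ℝ) + 2) ^ 2 ≤ cE P)
    (heRa : ∀ P i, (cE P + 1) * eR P i ≤ a₁ ∧ B₃ * ((cE P + 1) * eR P i) ≤ (theta13OfThm1CCMW F 2 j γ ε₀ ε₂₉ B₃ B₃' a₀ a₁).ν.εreg)
    (hcA : ∀ P, 1 / 2 * (B₃ * (cE P + 1) * (F.P P.K).eta 1 ^ 2) ^ 2 * (Fintype.card (Plaq (F.P P.K) 0) : ℝ) ≤ cA P)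
    -- TWO of dag-n24-c's V19 DOOR LETTERS: the sign `0 ≤ B₃` and [15] Thm 1's regularity sentence `h15` (⟸ K0⁷ stub 1's (8) top step, dag-n07-e) — its `(B₃, a₀, a₁)` ARE the [15]
    -- constants of the bookkeeping above (the witness's `εreg = a₀`, `rfl`); and the cube letter is POSITIVE, `1 ≤ j` (print's `M₁ = L^j ≥ 2`; the V19 cube letter is `j = ρ₀ + 3`)
    (hB : 0 ≤ B₃) (h15 : VariationalThm1RegSepCoP7M F 2 B₃ a₀ a₁) :
    ∃ R areg : ∀ P : B12.RunParams, ι P → ℝ, (∀ P i, 0 < R P i) ∧ (∀ P i, 0 < areg P i) ∧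
      ∀ P : B12.RunParams, lam.kSel P < P.K →
        B15Leaf (WOfRecord₁₃ F 2 (theta13OfThm1CCMW F 2 j γ ε₀ ε₂₉ B₃ B₃' a₀ a₁)
          { lam with LF := fun P => lfVarOn su2Chart fun i => InstOn.std (bgMSCoPOfRecord F 2 (theta13OfThm1CCMW F 2 j γ ε₀ ε₂₉ B₃ B₃' a₀ a₁).ν P.K (k P i) (maxDomT (theta13OfThm1CCMW F 2 j γ ε₀ ε₂₉ B₃ B₃' a₀ a₁).ν.M₁ (Z P i))) (theta13OfThm1CCMW F 2 j γ ε₀ ε₂₉ B₃ B₃' a₀ a₁).ν.M₁ (Z P i) (Λ P i) (k P i) (M P i) (areg P i)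
                            (anExt (pts (k P i) (Λ P i)) (T P i) (fun177std (bgMSCoPOfRecord F 2 (theta13OfThm1CCMW F 2 j γ ε₀ ε₂₉ B₃ B₃' a₀ a₁).ν P.K (k P i) (maxDomT (theta13OfThm1CCMW F 2 j γ ε₀ ε₂₉ B₃ B₃' a₀ a₁).ν.M₁ (Z P i))) (theta13OfThm1CCMW F 2 j γ ε₀ ε₂₉ B₃ B₃' a₀ a₁).ν.M₁ (Z P i) (k P i)) (ext P i)
                              (min (1 / 2) (min (R P i / 8) (γ₈ P / (M P i) ^ 5 * (R P i / 2) ^ 2 /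
                                (48 * (4 * ((Fintype.card (Plaq (F.P P.K) 0) : ℝ) * (1 + 8 * 𝓐₀ P i ^ 4)) / R P i + 1)))))) } P) := by
  -- `2 ≤ M₁ = L^j` at the window-edition witness (`1 ≤ j`, `1 < L`; `ν` is the collared member's, `rfl`); `εreg = a₀` (`rfl`)
  have h2 : 2 ≤ F.L ^ j :=
    calc 2 ≤ F.L := F.hL.2
      _ = F.L ^ 1 := (pow_one _).symm
      _ ≤ F.L ^ j := Nat.pow_le_pow_right (Nat.zero_lt_of_lt F.hL.2) hj
  exact exists_radius_pinLF_b15Leaf_WOfRecord₁₃_liveRepin₁₃_of_massLive_of_hasResiduals_of_variationalThm1RegSepCoP7M_atZSeqCoPRecord_nearFlatLoc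
    (theta13OfNumerics F 2 (stage12NumericsOfThm1CCMW F.L j γ ε₀ B₃ B₃' a₀ a₁) ε₂₉ (zeta316OfRecord F 2 (stage12NumericsOfThm1CCMW F.L j γ ε₀ B₃ B₃' a₀ a₁).ν (stage12NumericsOfThm1CCMW F.L j γ ε₀ B₃ B₃' a₀ a₁).τ9.M (stage12NumericsOfThm1CCMW F.L j γ ε₀ B₃ B₃' a₀ a₁).A₁) (RzOfRecord F 2) (ZtOfRecord F 2)) lam
    (hasResidualsOfRecord_theta13OfNumerics F 2 (stage12NumericsOfThm1CCMW F.L j γ ε₀ B₃ B₃' a₀ a₁) ε₂₉) (hM2 := h2) (hB₃ := hB) (ha₀ := le_of_eq rfl)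
    (h15 := h15)
    (hpin := hpin) (hmassLive := hmassLive) (h180 := h180) (h189 := h189) (hd3 := hd3) (h0 := h0) (ι := ι) (Z := Z) (Λ := Λ)
    (k := k) (M := M) (hk0 := hk0) (hk := hk) (eR := eR) (heR := heR) (T := T) (lo := lo) (hi := hi)
    (n := n) (hn := hn) (hN := hN) (hbox := hbox) (hZ := hZ) (hTG0 := hTG0) (hN5 := hN5) (Kb := Kb) (hK1 := hK1)
    (hKn := hKn) (ext := ext) (hext := hext) (hlohi := hlohi) (hγ := hγ) (hbx := hbx) (hbxM := hbxM) (hM := hM)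
    (hγ₀ := hγ₀) (hMinC := hMinC) (hδc0 := hδc0) (hμc0 := hμc0) (hρc0 := hρc0) (hδ₂c0 := hδ₂c0) (hNF := hNF) (hsm := hsm) (hγle := hγle) (hZ1 := hZ1)
    (hZblk := hZblk) (hdiv := hdiv) (hcE0 := hcE0) (hcE := hcE) (heRa := heRa) (hcA := hcA)

end AtThm1CCMW

end Summit.QuantumFields.YangMills.BalabanUVNodes.N12AtRecord13Prop1KnitThm1NearFlatLocOfRecord
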